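import Summits.BirchSwinnertonDyer.BirchSwinnertonDyer.Theorems.ByReductionTypeAtTwoAdditiveRankZeroResidualV4Exact
import HarnessLib

/-!
# Route `ByReductionTypeAtTwo` (rung K4), crux C4″ `AdditivePotMultOverKAtTwo` (item stmt-BirchSwinnertonDyer-22618, child of
# 19098 `AdditiveRankZeroAtTwo`, split v2.2): THE EXACT PRICE OF C4″ OVER `ℚ` — modulo print and the multiplicative sibling,
# C4″ (stated over the semistabilising quadratic fields `K`) is EQUIVALENT to `BSD₂` over `ℚ` on the potentially MULTIPLICATIVE
# additive sub-block, i.e. to its KATO HALF plus its EISENSTEIN HALF over `ℚ` there (a `--supports 22618` file; seat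
# `bsd-2adic-k4-w1` GEN 0; sequel of addL2x's `…AdditiveRankZeroResidualV4Exact`)

HONEST FRAMING (cell `bsd-2adic`, HUMAN RULING D-0036/D-0054): types-the-object-of; closes none at the ∀-level; nothing booked;
BSD is not proved by any of this. CONDITIONAL on PRINT BY NAME {`hGZK` Gross–Zagier–Kolyvagin, `hmod` modularity,
`hMilneC` Milne 1972 Weil restriction (any model), `hHL` Hoffstein–Luo} — all heads of the support item 22619 — and on the
sibling crux `MultiplicativeRankZeroAtTwo` (item 19096, itself split) BY NAME.

WHY. C4″ reads «the `2`-part of BSD for `E/K` over every quadratic field `K` semistabilising `E` at `2` with `L(E^{(d_K)}, 1) ≠ 0`,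
on the additive curves with `ord₂ j < 0`» (463 census classes; the habitat addL2x GEN 13 opened at 17:04Z with the road «Kato at
`2` reaches the pot-mult block»). V4Exact (p629xxx, `potMultOverK_of_additiveRankZeroAtTwo`) derives C4″ from the WHOLE parent; the
glue consumes C4″ through `addPotMult_bsdp_two_of_mult_of_overKC`. This file closes the circle ON THE SUB-BLOCK ITSELF, so that the
board reads C4″ in the same currency as C2″/C3″ (halves over `ℚ`):

* §1 `additivePotMultOverKAtTwo_of_bsdp_potMult` / `bsdp_potMult_of_additivePotMultOverKAtTwo` /
  **`additivePotMultOverKAtTwo_iff_bsdp_potMult`**: C4″ ⟺ `∀` non-CM globally minimal `W` with `r_an = 0`, additive at `2`,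
  `ord₂ j(W) < 0`: `BSDp W 2` — Milne's quadratic descent both ways (`missingPPartOverCAt_baseChange_iff_bsdp`), the twist
  `Wd` being MULTIPLICATIVE at `2` (`mult_of_semistableTwist_of_padicValRat_j_neg`) hence settled by the sibling, and an admissible
  `K` existing for every such `W` by Hoffstein–Luo (`existsSemistabilisingNonvanishingTwist_of_hoffsteinLuo`).
* §2 **`additivePotMultOverKAtTwo_iff_halves_potMult`**: C4″ ⟺ (KATO HALF `MissingUpperBoundAt W 2` on the block) ∧ (EISENSTEIN
  HALF `MissingLowerBoundAt W 2` on the block) — `Ш` finite by GZK in analytic rank `0`. So the supply roads are: upper half =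
  addL2x GEN 13's Kato-at-`2` reading on the NONSPLIT-twist sub-block (219/463 classes) + whatever reaches the 208 split-twist
  classes; lower half = the certificate currency of k4-w2's `…LowerHalfOrderWitness` (`missingLowerBoundAt_of_orderWitness_of_casselsTate`,
  any `p`, any reduction) or a main-conjecture-type input at multiplicative `2` over `K`. `additivePotMultOverKAtTwo_of_upper_of_lower`
  is the door BY NAME.

Nothing here is new mathematics (compositions of the lane-A/addL2x descent theorems); the point is the typed equivalence.
References: [Milne1972ArithmeticAV] §1 Thm. 1; [DokchitserDokchitserAnnals2010] §2.1; [HoffsteinLuo1997] Theorem; [Miller2011LMS] Def. 1.1.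
-/

set_option autoImplicit false
-- sibling precedent (`ByReductionTypeAtTwoAdditiveRankZeroResidualV4Exact.lean`): the directory name repeats the summit name
set_option linter.dupNamespace false

noncomputable section

open scoped Classical

namespace Summit.BirchSwinnertonDyer.BirchSwinnertonDyer.Theorems.AddKatoTwo

open WeierstrassCurve Literature.NumberTheory.EllipticCurves
  Literature.NumberTheory.EllipticCurves.Rank1Residual
  Literature.NumberTheory.EllipticCurves.Rank1Residual.Typed
  Summit.BirchSwinnertonDyer.Rank1Residual Summit.BirchSwinnertonDyer.Rank1Residual.AdditivePotMult
  Summit.BirchSwinnertonDyer.Rank1Residual.X5.AddTwoL2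
  Summit.BirchSwinnertonDyer.BirchSwinnertonDyer.Theses.ByReductionTypeAtTwo

/-! ## §1 C4″ ⟺ `BSD₂` over `ℚ` on the potentially multiplicative additive sub-block -/

/-- **`BSD₂` over `ℚ` on the potentially multiplicative additive sub-block ⟹ C4″**, granted GZK, modularity, Milne any-model and the
multiplicative sibling BY NAME: for an admissible `K` the minimal semistable twist `Wd` is multiplicative at `2` (`ord₂ j < 0`), so
`hMult` settles `BSD₂(Wd)`, and Milne's descent converts `BSD₂(W)` into the `2`-part over `K` on `W ⊗ K`. The proof of V4Exact's
`potMultOverK_of_additiveRankZeroAtTwo`, with the parent restricted to the sub-block. [cite: Milne1972ArithmeticAV, §1 Thm. 1]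
[cite: DokchitserDokchitserAnnals2010, §2.1] -/
theorem additivePotMultOverKAtTwo_of_bsdp_potMult (hGZK : rank_eq_analyticRank_of_analyticRank_le_one)
    (hmod : hasEntireLFunction_rat) (hMilneC : Milne1972.bsdQuotient_baseChange_quadratic_anyModel)
    (hMult : MultiplicativeRankZeroAtTwo)
    (h : ∀ (W : WeierstrassCurve ℚ) [W.IsElliptic] [W.IsGloballyMinimal], ¬ W.HasCM → W.analyticRank = 0 →
      Addv W 2 → padicValRat 2 W.j < 0 → BSDp W 2) :
    AdditivePotMultOverKAtTwo := by
  intro W _ _ hcm hr hadd hj K _ _ h2 hst hL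
  haveI : Fact (Nat.Prime 2) := ⟨Nat.prime_two⟩
  obtain ⟨Wd, _, _, hWd, hcmd, hrd, hred⟩ := Theorems.exists_minimalTwist_semistable_rankZero W hcm K hst hL
  have hdK : (NumberField.discr K : ℚ) ≠ 0 := by exact_mod_cast NumberField.discr_ne_zero K
  have hm : Mult Wd 2 := mult_of_semistableTwist_of_padicValRat_j_neg W hj hdK Wd hWd hred
  have hd : BSDp Wd 2 := hMult Wd hcmd hrd hm
  exact (missingPPartOverCAt_baseChange_iff_bsdp W 2 K Wd hGZK hmod hMilneC (by rw [hr]; exact zero_le_one) h2 hWd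
    (by rw [hrd]; exact zero_le_one) hd).mpr (h W hcm hr hadd hj)

/-- **C4″ ⟹ `BSD₂` over `ℚ` on the potentially multiplicative additive sub-block**, granted GZK, modularity, Milne any-model,
Hoffstein–Luo and the multiplicative sibling BY NAME — p627985's `addPotMult_bsdp_two_of_mult_of_overKC` fed with the route decl
(an admissible `K` exists for every such `W` by Hoffstein–Luo). [cite: HoffsteinLuo1997, Theorem] [cite: Milne1972ArithmeticAV, §1 Thm. 1] -/
theorem bsdp_potMult_of_additivePotMultOverKAtTwo (hGZK : rank_eq_analyticRank_of_analyticRank_le_one)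
    (hmod : hasEntireLFunction_rat) (hMilneC : Milne1972.bsdQuotient_baseChange_quadratic_anyModel)
    (hHL : HoffsteinLuo1997_exists_twist_L_one_ne_zero) (hMult : MultiplicativeRankZeroAtTwo)
    (h : AdditivePotMultOverKAtTwo) :
    ∀ (W : WeierstrassCurve ℚ) [W.IsElliptic] [W.IsGloballyMinimal], ¬ W.HasCM → W.analyticRank = 0 →
      Addv W 2 → padicValRat 2 W.j < 0 → BSDp W 2 :=
  addPotMult_bsdp_two_of_mult_of_overKC hGZK hmod hMilneC hHL hMult (fun W _ _ ↦ h W)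

/-- **The exact price of C4″ over `ℚ`.** Granted PRINT {GZK, modularity, Milne any-model, Hoffstein–Luo} and the sibling
`MultiplicativeRankZeroAtTwo` BY NAME: `AdditivePotMultOverKAtTwo` ⟺ `BSD₂(W)` for every non-CM globally minimal `W/ℚ` with
`r_an = 0`, additive reduction at `2` and `ord₂ j(W) < 0`. The over-`K` dress of C4″ carries no content beyond the parent crux
restricted to the potentially multiplicative sub-block. Conditional iff; nothing asserted about either side.
[cite: Milne1972ArithmeticAV, §1 Thm. 1] [cite: HoffsteinLuo1997, Theorem] [cite: Miller2011LMS, §1 and Def. 1.1] -/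
theorem additivePotMultOverKAtTwo_iff_bsdp_potMult (hGZK : rank_eq_analyticRank_of_analyticRank_le_one)
    (hmod : hasEntireLFunction_rat) (hMilneC : Milne1972.bsdQuotient_baseChange_quadratic_anyModel)
    (hHL : HoffsteinLuo1997_exists_twist_L_one_ne_zero) (hMult : MultiplicativeRankZeroAtTwo) :
    AdditivePotMultOverKAtTwo ↔
      ∀ (W : WeierstrassCurve ℚ) [W.IsElliptic] [W.IsGloballyMinimal], ¬ W.HasCM → W.analyticRank = 0 →
        Addv W 2 → padicValRat 2 W.j < 0 → BSDp W 2 :=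
  ⟨bsdp_potMult_of_additivePotMultOverKAtTwo hGZK hmod hMilneC hHL hMult,
    additivePotMultOverKAtTwo_of_bsdp_potMult hGZK hmod hMilneC hMult⟩

/-! ## §2 C4″ ⟺ Kato half ∧ Eisenstein half over `ℚ` on the sub-block -/

/-- **C4″ from the two halves over `ℚ` on the potentially multiplicative sub-block** (the door BY NAME for the supply roads:
upper = Kato at `2` on the block, lower = order-witness certificates or a main-conjecture-type input), granted GZK, modularity,
Milne any-model and the multiplicative sibling. [cite: Miller2011LMS, §1 and Def. 1.1] [cite: Milne1972ArithmeticAV, §1 Thm. 1] -/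
theorem additivePotMultOverKAtTwo_of_upper_of_lower (hGZK : rank_eq_analyticRank_of_analyticRank_le_one)
    (hmod : hasEntireLFunction_rat) (hMilneC : Milne1972.bsdQuotient_baseChange_quadratic_anyModel)
    (hMult : MultiplicativeRankZeroAtTwo)
    (hUp : ∀ (W : WeierstrassCurve ℚ) [W.IsElliptic] [W.IsGloballyMinimal], ¬ W.HasCM → W.analyticRank = 0 →
      Addv W 2 → padicValRat 2 W.j < 0 → MissingUpperBoundAt W 2)
    (hLow : ∀ (W : WeierstrassCurve ℚ) [W.IsElliptic] [W.IsGloballyMinimal], ¬ W.HasCM → W.analyticRank = 0 →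
      Addv W 2 → padicValRat 2 W.j < 0 → MissingLowerBoundAt W 2) :
    AdditivePotMultOverKAtTwo := by
  refine additivePotMultOverKAtTwo_of_bsdp_potMult hGZK hmod hMilneC hMult ?_
  intro W _ _ hcm hr hadd hj
  haveI : Fact (Nat.Prime 2) := ⟨Nat.prime_two⟩
  exact bsdp_of_missingPPartAt W 2 hGZK (by rw [hr]; exact zero_le_one)
    (missingPPartAt_of_lower_of_upper W 2 (hLow W hcm hr hadd hj) (hUp W hcm hr hadd hj))

/-- **C4″ ⟹ the two halves over `ℚ` on the sub-block** (`Ш` finite by GZK in analytic rank `0`), granted PRINT + Hoffstein–Luo +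
the multiplicative sibling BY NAME. [cite: Miller2011LMS, §1 and Def. 1.1] -/
theorem halves_potMult_of_additivePotMultOverKAtTwo (hGZK : rank_eq_analyticRank_of_analyticRank_le_one)
    (hmod : hasEntireLFunction_rat) (hMilneC : Milne1972.bsdQuotient_baseChange_quadratic_anyModel)
    (hHL : HoffsteinLuo1997_exists_twist_L_one_ne_zero) (hMult : MultiplicativeRankZeroAtTwo)
    (h : AdditivePotMultOverKAtTwo) :
    ∀ (W : WeierstrassCurve ℚ) [W.IsElliptic] [W.IsGloballyMinimal], ¬ W.HasCM → W.analyticRank = 0 →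
      Addv W 2 → padicValRat 2 W.j < 0 → MissingLowerBoundAt W 2 ∧ MissingUpperBoundAt W 2 := by
  intro W _ _ hcm hr hadd hj
  haveI : Fact (Nat.Prime 2) := ⟨Nat.prime_two⟩
  have hr1 : W.analyticRank ≤ 1 := by rw [hr]; exact zero_le_one
  haveI : Finite W.sha := (hGZK W hr1).2
  exact lower_and_upper_of_missingPPartAt W 2
    (missingPPartAt_of_bsdp W 2 (bsdp_potMult_of_additivePotMultOverKAtTwo hGZK hmod hMilneC hHL hMult h W hcm hr hadd hj))

/-- **The exact price of C4″ in halves.** Granted PRINT {GZK, modularity, Milne any-model, Hoffstein–Luo} and the multiplicative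
sibling BY NAME: `AdditivePotMultOverKAtTwo` ⟺ (the KATO HALF `MissingUpperBoundAt W 2` for every non-CM globally minimal
`r_an = 0` curve additive at `2` with `ord₂ j < 0`) ∧ (the EISENSTEIN HALF `MissingLowerBoundAt W 2` for the same curves) — the
currency of C2″/C3″ on the potentially good sub-block, now for C4″. Conditional iff; nothing asserted about either side.
[cite: Miller2011LMS, §1 and Def. 1.1] [cite: Milne1972ArithmeticAV, §1 Thm. 1] [cite: HoffsteinLuo1997, Theorem] -/
theorem additivePotMultOverKAtTwo_iff_halves_potMult (hGZK : rank_eq_analyticRank_of_analyticRank_le_one)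
    (hmod : hasEntireLFunction_rat) (hMilneC : Milne1972.bsdQuotient_baseChange_quadratic_anyModel)
    (hHL : HoffsteinLuo1997_exists_twist_L_one_ne_zero) (hMult : MultiplicativeRankZeroAtTwo) :
    AdditivePotMultOverKAtTwo ↔
      (∀ (W : WeierstrassCurve ℚ) [W.IsElliptic] [W.IsGloballyMinimal], ¬ W.HasCM → W.analyticRank = 0 →
          Addv W 2 → padicValRat 2 W.j < 0 → MissingUpperBoundAt W 2) ∧
        (∀ (W : WeierstrassCurve ℚ) [W.IsElliptic] [W.IsGloballyMinimal], ¬ W.HasCM → W.analyticRank = 0 →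
          Addv W 2 → padicValRat 2 W.j < 0 → MissingLowerBoundAt W 2) := by
  constructor
  · intro h
    exact ⟨fun W _ _ hcm hr hadd hj ↦ (halves_potMult_of_additivePotMultOverKAtTwo hGZK hmod hMilneC hHL hMult h W hcm hr hadd hj).2,
      fun W _ _ hcm hr hadd hj ↦ (halves_potMult_of_additivePotMultOverKAtTwo hGZK hmod hMilneC hHL hMult h W hcm hr hadd hj).1⟩
  · rintro ⟨hUp, hLow⟩
    exact additivePotMultOverKAtTwo_of_upper_of_lower hGZK hmod hMilneC hMult hUp hLow

end Summit.BirchSwinnertonDyer.BirchSwinnertonDyer.Theorems.AddKatoTwo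

end
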